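import Summits.BirchSwinnertonDyer.BirchSwinnertonDyer.Theorems.SignedBaseChangeAnticyclotomicEisensteinDivisibilityAlmostDivisibleAssembly
import Summits.BirchSwinnertonDyer.BirchSwinnertonDyer.Theorems.SignedBaseChangeAnticyclotomicEisensteinDivisibilityXGrTwoModuleFinite
import Summits.BirchSwinnertonDyer.BirchSwinnertonDyer.Theorems.SignedBaseChangeAnticyclotomicEisensteinDivisibilitySpecializationRat
import Literature.NumberTheory.DiophantineGeometry.LocalReductionFiniteBadPlacesProofs
import Literature.NumberTheory.EllipticCurves.GoodReductionUnramifiedProofs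
import HarnessLib

/-!
# The TELESCOPE of the width seat's Greenberg-2016 road for `stub_finiteExponentSS` (crux
# `AnticyclotomicEisensteinDivisibility`, stmt-BirchSwinnertonDyer-20727, line `bdpline`): the finite
# exponent of `X_Gr₂[T₁]` at `(T₁) ∉ Supp X_Gr₂` from SIX published facts BY NAME and the TWO instance
# bricks (R1a) `E[p^∞]` cofree with a Tate-dual basis, (R1b) LOC⁽¹⁾ / `h⁰ = 0` for the twist deformation

Lead seat bsd-line-sbc-p1 gen 3 (2026-08-28); closes the step (R3′) of bsd-line-sbc-p1-w2 gen 3's note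
`finite-exponent-greenberg-road-w2g3.md` over their kernel-checked assembly
`SignedBaseChangeAcDivAssembly.xGr₂_hasNoPseudoNullSubmodule_curve` (p627029): the set `S` (places
above `p` or of bad reduction; finite), the Néron–Ogg–Shafarevich input `hNS`
(`smul_primaryTorsion_eq_of_mem_ramificationSubgroup`), the descended `ρ₀`
(`exists_continuousRep_primaryTorsion`), and — the one observation added here — the `Λ₂`-TORSION of
`X_Gr₂`, which the registered stub does not carry as a binder but which follows INSIDE the stub from its
own hypothesis `length_{(T₁)}(X_Gr₂) = 0` (an element `s ∉ (T₁)` kills the finitely generated `X_Gr₂`,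
`LocalLength.exists_notMem_forall_smul_eq_zero_of_lengthAt_eq_zero`). Output: no non-zero pseudo-null
submodule, hence (`S2.pow_smul_torsionBy_eq_zero_of_noPseudoNull`) the stub's conclusion with `m = 0`.

* `finiteExponent_of_bricks` — for `W` elliptic over an imaginary quadratic `K`, `2 < p = v v̄`, a
  generator pair, topological instances as in the assembly (any; the skeleton takes the discrete ones),
  the six facts, (R1a) and (R1b) stated for the canonical `S` and EVERY descended `ρ₀`:
  `length_{(T₁)}(X_Gr₂) = 0 ⟹ ∀ x, T₁ x = 0 → x = 0`-strength conclusion in the registered shape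
  `∃ m, ∀ x, T₁ • x = 0 → p^m • x = 0`.

Theorems only; route-independent (no `Theses` import). BSD / the crux are not proved by this file: the
six facts and the two bricks are HYPOTHESES here.

References: R. Greenberg, *On the structure of Selmer groups* (2016), Prop. 4.1.1; R. Greenberg, *On the
structure of certain Galois cohomology groups*, Doc. Math. (2006), Props. 3.2, 4.1, 4.2, §5 A;
R. Greenberg, *Surjectivity of the global-to-local map defining a Selmer group* (2010), Lemma 5.2.2.
-/

-- D-0017: single-problem summit, the namespace repeats the problem name by design.
set_option linter.dupNamespace false
set_option autoImplicit false

noncomputable section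

open scoped Classical
open NumberField IsDedekindDomain Field
open Literature.NumberTheory.EllipticCurves Literature.NumberTheory.GaloisRepresentations
  Literature.NumberTheory.EllipticCurves.Rubin1991
  Literature.NumberTheory.IwasawaTheory Literature.NumberTheory.IwasawaTheory.Greenberg2006
  Literature.NumberTheory.IwasawaTheory.Greenberg2016
  Summit.BirchSwinnertonDyer.BirchSwinnertonDyer.Theorems.SignedBaseChangeAcDivCurveModel
  Summit.BirchSwinnertonDyer.BirchSwinnertonDyer.Theorems.SignedBaseChangeAcDivAssembly

namespace Summit.BirchSwinnertonDyer.BirchSwinnertonDyer.Theorems.SignedBaseChangeAcDivFiniteExponentTelescope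

/-- The canonical set of places of the road (`{w ∣ p} ∪ {bad w}`) contains the places above `p` (its
defining clause). [cite: Greenberg2016Selmer, §1 p. 3 (the set `Σ ⊇ {v ∣ p}`)] -/
theorem mem_badOrP_of_natCast_mem {K : Type} [Field K] [NumberField K] (W : WeierstrassCurve K) (p : ℕ)
    (v : HeightOneSpectrum (𝓞 K)) (hv : ((p : ℕ) : 𝓞 K) ∈ v.asIdeal) :
    v ∈ {w : HeightOneSpectrum (𝓞 K) | ((p : ℕ) : 𝓞 K) ∈ w.asIdeal ∨ ¬ W.HasGoodReductionAt w} :=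
  Or.inl hv

variable {K : Type} [Field K] [NumberField K] {p : ℕ} [Fact p.Prime] (W : WeierstrassCurve K) [W.IsElliptic]
  [TopologicalSpace (PowerSeries ℤ_[p])] [TopologicalSpace (PowerSeries (PowerSeries ℤ_[p]))]
  [IsTopologicalRing (PowerSeries (PowerSeries ℤ_[p]))]
  [IsTopologicalAddGroup (IndModule₂ ℤ_[p] p (PrimaryTorsion W.geomPoints p))]
  [ContinuousSMul (PowerSeries (PowerSeries ℤ_[p])) (IndModule₂ ℤ_[p] p (PrimaryTorsion W.geomPoints p))]
  (κ₁ κ₂ : ZpExtension K p) (vbar : HeightOneSpectrum (𝓞 K)) (γ₁ γ₂ : absoluteGaloisGroup K)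
  [hγ : Fact (ZpExtension.IsTopGeneratorPair κ₁ κ₂ γ₁ γ₂)]

omit [TopologicalSpace (PowerSeries ℤ_[p])] [TopologicalSpace (PowerSeries (PowerSeries ℤ_[p]))]
  [IsTopologicalRing (PowerSeries (PowerSeries ℤ_[p]))]
  [IsTopologicalAddGroup (IndModule₂ ℤ_[p] p (PrimaryTorsion W.geomPoints p))]
  [ContinuousSMul (PowerSeries (PowerSeries ℤ_[p])) (IndModule₂ ℤ_[p] p (PrimaryTorsion W.geomPoints p))] in
/-- **Inside the stub, `X_Gr₂` is `Λ₂`-torsion**: if `length_{(T₁)}(X_Gr₂) = 0` then some `s ∉ (T₁)`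
(in particular `s ≠ 0`) kills the finitely generated `X_Gr₂` (tree: `xGr₂_module_finite`,
`LocalLength.exists_notMem_forall_smul_eq_zero_of_lengthAt_eq_zero`). [cite: Washington1997, §13.2 (pseudo-null modules over Λ)] -/
theorem xGr₂_isTorsion_of_lengthAt_eq_zero
    (h0 : Literature.NumberTheory.EllipticCurves.Module.lengthAt (IwasawaAlgebra₂ p) (W.XGr₂ p κ₁ κ₂ vbar γ₁ γ₂)
      ⟨Ideal.span {(PowerSeries.X : IwasawaAlgebra₂ p)}, PowerSeries.span_X_isPrime⟩ = 0) :
    Module.IsTorsion (IwasawaAlgebra₂ p) (W.XGr₂ p κ₁ κ₂ vbar γ₁ γ₂) := by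
  haveI : Module.Finite (IwasawaAlgebra₂ p) (W.XGr₂ p κ₁ κ₂ vbar γ₁ γ₂) :=
    SignedBaseChangeAcDivFinitePiece.xGr₂_module_finite W p κ₁ κ₂ vbar
  obtain ⟨s, hsX, hsm⟩ :=
    SignedBaseChangeAcDivSpecialization.LocalLength.exists_notMem_forall_smul_eq_zero_of_lengthAt_eq_zero h0
  have hs0 : s ≠ 0 := fun h ↦ hsX (by rw [h]; exact Ideal.zero_mem _)
  intro x
  exact ⟨⟨s, mem_nonZeroDivisors_of_ne_zero hs0⟩, hsm x⟩

/-- **The telescope (R3′)**: the registered stub's conclusion — at `length_{(T₁)}(X_Gr₂) = 0` a power of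
`p` kills `X_Gr₂[T₁]` (indeed `m = 0`) — for an elliptic curve `W` over an imaginary quadratic `K`,
`2 < p = v v̄` split, a generator pair `(γ₁, γ₂)` of `(κ₁, κ₂)`, GRANTED: the six published facts by name
(Greenberg 2016 Props. 4.1.1/4.2.2; Greenberg 2006 Props. 3.2/4.1/4.2/§5 A), (R1a) `E[p^∞]` cofree over
`ℤ_p` with a basis of a Tate dual, and (R1b) LOC⁽¹⁾ and `h⁰ = 0` for the twist deformation of EVERY
descended `ρ₀` on the canonical `S = {w ∣ p} ∪ {bad w}`. The torsion of `X_Gr₂` is derived from the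
length hypothesis (`xGr₂_isTorsion_of_lengthAt_eq_zero`); `S` is finite (`finite_setOf_natCast_mem`,
`finite_badPlaces_holds`); `N_S` fixes `E[p^∞]` (`smul_primaryTorsion_eq_of_mem_ramificationSubgroup`);
`ρ₀` exists (`exists_continuousRep_primaryTorsion`); then `xGr₂_hasNoPseudoNullSubmodule_curve` and
`S2.pow_smul_torsionBy_eq_zero_of_noPseudoNull`. [cite: Greenberg2016Selmer, Prop. 4.1.1 (c) (§4.1 p. 15)]
[cite: Greenberg2006, Props. 3.2, 4.1, 4.2, §5 A] [cite: Greenberg2010, Lemma 5.2.2] -/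
theorem finiteExponent_of_bricks
    (h411 : prop411_selmer_isAlmostDivisible) (h422 : prop422_localCohomology_isAlmostDivisible)
    (h5A : sec5A_localH2_subsingleton_of_LOC1) (h41 : prop41_globalEulerPoincareCorank)
    (h42 : prop42_localEulerPoincareCorank) (h32 : prop32_cohomology_isCofinitelyGenerated)
    (hp : 2 < p) (hK : IsImaginaryQuadratic K)
    {v : HeightOneSpectrum (𝓞 K)} (hv : ((p : ℕ) : 𝓞 K) ∈ v.asIdeal)
    (hvbar : ((p : ℕ) : 𝓞 K) ∈ vbar.asIdeal) (hne : vbar ≠ v)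
    -- (R1a)
    (hcofree : IsCofree ℤ_[p] (PrimaryTorsion W.geomPoints p))
    (hTate : ∃ (Y : Type) (_ : AddCommGroup Y) (_ : Module ℤ_[p] Y)
      (tA : Y →+ (PrimaryTorsion W.geomPoints p →+ DiscreteGaloisModule.UnitsCarrier K))
      (_ : IsDualPairing ℤ_[p] (PrimaryTorsion W.geomPoints p) tA) (n : ℕ),
      Nonempty (Module.Basis (Fin n) ℤ_[p] Y))
    -- (R1b) for the canonical `S` and every descended `ρ₀`
    (hR1b : ∀ (ρ₀ : ContinuousRep
        (GaloisGroupUnramifiedOutside K {w : HeightOneSpectrum (𝓞 K) | ((p : ℕ) : 𝓞 K) ∈ w.asIdeal ∨ ¬ W.HasGoodReductionAt w})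
        ℤ_[p] (PrimaryTorsion W.geomPoints p)),
      (∀ (σ : absoluteGaloisGroup K) (P : PrimaryTorsion W.geomPoints p),
        ρ₀ (toUnramifiedQuot K _ σ) P = σ • P) →
      (∀ w : HeightOneSpectrum (𝓞 K), w ∈ {w : HeightOneSpectrum (𝓞 K) | ((p : ℕ) : 𝓞 K) ∈ w.asIdeal ∨ ¬ W.HasGoodReductionAt w} →
          LOC1 _ (twistDeformation _ (mem_badOrP_of_natCast_mem W p) κ₁ κ₂ ρ₀) (Sum.inr w)) ∧
        (∀ w : HeightOneSpectrum (𝓞 K), w ∈ {w : HeightOneSpectrum (𝓞 K) | ((p : ℕ) : 𝓞 K) ∈ w.asIdeal ∨ ¬ W.HasGoodReductionAt w} →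
          HasCorank (IwasawaAlgebra₂ p)
            ((localRep _ (twistDeformation _ (mem_badOrP_of_natCast_mem W p) κ₁ κ₂ ρ₀) (Sum.inr w)).H 0) 0) ∧
        HasCorank (IwasawaAlgebra₂ p)
          ((twistDeformation _ (mem_badOrP_of_natCast_mem W p) κ₁ κ₂ ρ₀).H 0) 0)
    (h0 : Literature.NumberTheory.EllipticCurves.Module.lengthAt (IwasawaAlgebra₂ p) (W.XGr₂ p κ₁ κ₂ vbar γ₁ γ₂)
      ⟨Ideal.span {(PowerSeries.X : IwasawaAlgebra₂ p)}, PowerSeries.span_X_isPrime⟩ = 0) :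
    ∃ m : ℕ, ∀ x : W.XGr₂ p κ₁ κ₂ vbar γ₁ γ₂,
      (PowerSeries.X : IwasawaAlgebra₂ p) • x = 0 → ((p : IwasawaAlgebra₂ p) ^ m) • x = 0 := by
  set S : Set (HeightOneSpectrum (𝓞 K)) :=
    {w : HeightOneSpectrum (𝓞 K) | ((p : ℕ) : 𝓞 K) ∈ w.asIdeal ∨ ¬ W.HasGoodReductionAt w} with hSdef
  have hS : ∀ w : HeightOneSpectrum (𝓞 K), ((p : ℕ) : 𝓞 K) ∈ w.asIdeal → w ∈ S :=
    mem_badOrP_of_natCast_mem W p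
  have hSbad : ∀ w : HeightOneSpectrum (𝓞 K), ¬ W.HasGoodReductionAt w → w ∈ S := fun w hw ↦ Or.inr hw
  have hSf : S.Finite := by
    refine ((IsDedekindDomain.HeightOneSpectrum.finite_setOf_natCast_mem (R := 𝓞 K)
      (Fact.out : p.Prime).ne_zero).union (W.finite_badPlaces_holds (𝓞 K))).subset ?_
    rintro w (hw | hw)
    · exact Or.inl hw
    · exact Or.inr hw
  -- Néron–Ogg–Shafarevich and the descended `ρ₀`
  have hNS : ∀ n ∈ ramificationSubgroup K S, ∀ P : PrimaryTorsion W.geomPoints p, n • P = P :=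
    fun n hn P ↦ smul_primaryTorsion_eq_of_mem_ramificationSubgroup W p S hSbad hS hn P
  obtain ⟨ρ₀, hρ₀⟩ := exists_continuousRep_primaryTorsion W p S hNS
  obtain ⟨hLOC1, h0loc, h00⟩ := hR1b ρ₀ hρ₀
  -- torsion from the length hypothesis
  have htors := xGr₂_isTorsion_of_lengthAt_eq_zero W κ₁ κ₂ vbar γ₁ γ₂ h0
  -- no non-zero pseudo-null submodule (the width seat's assembly), hence `m = 0`
  have hPN := xGr₂_hasNoPseudoNullSubmodule_curve W hS κ₁ κ₂ ρ₀ vbar γ₁ γ₂ h411 h422 h5A h41 h42 h32 hSf hp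
    hK hv hvbar hne hNS hρ₀ htors hcofree hTate hLOC1 h0loc h00
  exact SignedBaseChangeAcDivSpecialization.S2.pow_smul_torsionBy_eq_zero_of_noPseudoNull p _ h0
    ((hasNoPseudoNullSubmodule_iff _).1 hPN)

end Summit.BirchSwinnertonDyer.BirchSwinnertonDyer.Theorems.SignedBaseChangeAcDivFiniteExponentTelescope

end
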